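import Summits.BirchSwinnertonDyer.Rank1Residual.GaloisImage.SupersingularNonsplitCartanNormalizer
import Literature.NumberTheory.EllipticCurves.Rank1Residual.FineMordellWeilCertificates
import Literature.NumberTheory.GaloisRepresentations.DecompositionGroupOfCompletion
import HarnessLib

/-!
# Route `SignedLowerHalves` (K3), crux M `SmallImageMuZeroOneSign` (item stmt-BirchSwinnertonDyer-23600), line `birth_mu` —
# `E(ℚ_p)[p] = 0` at every good SUPERSINGULAR prime `p ≠ 2`: the per-pair certificate input `CleanAtP W p` is a THEOREM

LEAD seat `cruxlead-stmt-BirchSwinnertonDyer-23600` gen 3 (cell `bsd-ssimc`; `--supports stmt-BirchSwinnertonDyer-23600`, helper).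
HONEST FRAMING: THEOREMS ONLY (no definition, no named fact, no instance, no `sorry`); nothing is booked; crux M, crux 4 and
BSD are NOT proved by this file.  What it removes is ONE displayed hypothesis of the per-pair doors of the crux's second line
`Lines/fine_pivot.lean` v1.5 §Door 1‴/1⁗ (bsd-idea-5 g12): the support stub `stub_cleanAtP_goodSS : CleanAtPOnGoodSS`
(«`p ≠ 2 → GoodSS W p → CleanAtP W p`») is PROVED here, verbatim, as `cleanAtPOnGoodSS`.

## The statement and its proof

`Rank1Residual.CleanAtP W p` (file `Rank1Residual/FineMordellWeilCertificates`; hypothesis (c3) at `v = p` of Deo–Ray–Sujatha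
2023 Thm. 3.9, «`p` is not a local torsion prime» of Ray–Sujatha 2023): for the place `v` of `ℚ` above `p`, no non-zero
`p`-torsion point of `E(ℚ̄)` is fixed by the decomposition group `D_v = GreenbergSelmer.decomp v` — i.e. `E(ℚ_p)[p] = 0`.

At a good supersingular `p ≠ 2` this holds for EVERY elliptic curve over `ℚ` (no image, CM or conductor hypothesis):
Serre 1972 §1.11 Prop. 12 c) — the inertia group `I_𝔏 ⊆ D_v` of the prime `𝔏 ∣ p` of `ℤ̄` acts on `E[p]` through a CYCLIC
group of order `p² − 1` (tree theorem, frame-free: `GaloisImage.isCyclic_and_card_inertia_map_of_goodSS`, b2b cell) — and a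
generator `ρ̄(τ)` fixing a non-zero `P ∈ E[p]` would act on the line `ℤ·P` trivially and on `E[p]/ℤ·P` by a scalar
`d ∈ 𝔽_pˣ`, so `ρ̄(τ)^{p−1}` would be unipotent and `ρ̄(τ)^{p(p−1)} = 1`: `p² − 1 ∣ p(p − 1)`, absurd.  (Equivalently:
`#Ẽ(𝔽_p) = p + 1 − a_p ≡ 1 (mod p)` and `Ê(pℤ_p)` is torsion-free — Silverman VII.3.1; the Galois-side proof is the one the
tree's vocabulary supports.)  The argument is the tree's `hasIrreducibleModPGaloisRep_of_dvd_frobeniusTrace`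
(`SupersingularIrreducibleProofs`, a `Γ_ℚ`-stable line) run on the `τ`-stable line `ℤ·P` instead.

## Contents
* `geomTorsion_eq_zero_of_forall_inertia_smul_eq` — **`E[p]^{I_𝔏} = 0`** at a good supersingular `p ≠ 2`, for every prime
  `𝔏` of `ℤ̄` above `p`.
* `geomTorsion_eq_zero_of_forall_decomp_smul_eq` — the same for the decomposition group `GreenbergSelmer.decomp v`.
* `cleanAtP_of_goodSS` — **`GoodSS W p`, `p ≠ 2` ⟹ `CleanAtP W p`**.
* `cleanAtPOnGoodSS` — the quantified form = the body of `Lines/fine_pivot.lean`'s `CleanAtPOnGoodSS` / `stub_cleanAtP_goodSS`,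
  VERBATIM.
* `cleanAtP_of_classX7` — on crux M's domain (`ClassX7 W p`, `p ≠ 2`).

References: [Serre1972] §1.11 Prop. 12 c); [SilvermanAEC2009] VII.3.1; [RaySujatha2021] §2 («local torsion primes», arXiv:2112.13335
p. 7); [DeoRaySujatha2023] §3 hypothesis (c3) (arXiv:2202.09937 pp. 9–10).
-/

set_option autoImplicit false
set_option linter.dupNamespace false

noncomputable section

open scoped Classical NumberField

open IsDedekindDomain Field NumberField WeierstrassCurve Rat.HeightOneSpectrum
  Literature.NumberTheory.EllipticCurves Literature.NumberTheory.GaloisRepresentations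
  Literature.NumberTheory.EllipticCurves.Rank1Residual
  Summit.BirchSwinnertonDyer.Rank1Residual.GaloisImage

namespace Summit.BirchSwinnertonDyer.BirchSwinnertonDyer.Theorems.SmallImageCleanAtP

variable (W : WeierstrassCurve ℚ) [W.IsElliptic] [W.IsGloballyMinimal] (p : ℕ) [hp : Fact p.Prime]

/-- **`E[p]^{I_𝔏} = 0` at a good supersingular `p ≠ 2`** (Serre 1972 §1.11 Prop. 12 c)): for `W/ℚ` (global minimal model)
with good supersingular reduction at `p ≠ 2`, a place `v ∣ p` and a prime `𝔏` of `ℤ̄` above `v`, a `p`-torsion point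
`P ∈ E[p](ℚ̄)` fixed by every element of the inertia group `I_𝔏 ≤ Γ_ℚ` is zero.  Proof: `ρ̄(I_𝔏)` is cyclic of order
`p² − 1` (`isCyclic_and_card_inertia_map_of_goodSS`); a generator `ρ̄(τ)` fixes the line `ℤ·P` pointwise and acts on
`E[p]/ℤ·P` by a scalar prime to `p`, so `ρ̄(τ)^{p-1}` is unipotent (`pow_prime_smul_eq_self_of_unipotent`) and
`ρ̄(τ)^{p(p-1)} = 1`, forcing `p² − 1 ∣ p(p − 1) < p² − 1`. [cite: Serre1972, §1.11 Prop. 12 c)] -/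
theorem geomTorsion_eq_zero_of_forall_inertia_smul_eq (hp2 : p ≠ 2) (hss : GoodSS W p)
    {v : HeightOneSpectrum (𝓞 ℚ)} (hv : (primesEquiv v : ℕ) = p)
    {𝔏 : Ideal (absIntegers (𝓞 ℚ) ℚ)} (h𝔏 : 𝔏 ∈ v.primesAbove)
    (P : geomTorsion W (p : ℤ)) (hP : ∀ σ ∈ 𝔏.inertia (absoluteGaloisGroup ℚ), σ • P = P) : P = 0 := by
  have hpp : p.Prime := hp.out
  by_contra hP0
  -- the cyclic inertia image and a generator `ρ̄(τ)` of order `p² - 1`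
  obtain ⟨hcyc, hcard⟩ := isCyclic_and_card_inertia_map_of_goodSS W p hp2 hss hv h𝔏
  set G := (𝔏.inertia (absoluteGaloisGroup ℚ)).map (galoisRepTorsion W (p : ℤ)) with hGdef
  haveI := hcyc
  obtain ⟨g, hg⟩ := IsCyclic.exists_ofOrder_eq_natCard (α := G)
  obtain ⟨τ, hτI, hτg⟩ := Subgroup.mem_map.mp g.2
  have hordτ : orderOf (galoisRepTorsion W (p : ℤ) τ) = p ^ 2 - 1 := by
    rw [hτg, Subgroup.orderOf_coe, hg, hcard]
  have hτP : τ • P = P := hP τ hτI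
  -- the `τ`-stable line `Φ = ℤ·P`, of order `p`
  have hptor : ∀ Q : geomTorsion W (p : ℤ), ((p : ℕ) : ℤ) • Q = 0 := fun Q ↦ by
    rw [← Subtype.coe_inj, AddSubgroupClass.coe_zsmul, ZeroMemClass.coe_zero]
    exact (Submodule.mem_torsionBy_iff _ _).mp Q.2
  set Φ : AddSubgroup (geomTorsion W (p : ℤ)) := AddSubgroup.zmultiples P with hΦdef
  have hΦ : Nat.card Φ = p := by
    rw [hΦdef, Nat.card_zmultiples]
    refine addOrderOf_eq_prime ?_ hP0
    rw [← natCast_zsmul]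
    exact hptor P
  have hfixΦ : ∀ Q ∈ Φ, τ • Q = Q := fun Q hQ ↦ by
    obtain ⟨m, rfl⟩ := AddSubgroup.mem_zmultiples_iff.mp hQ
    rw [show τ • (m • P) = m • (τ • P) from map_zsmul (DistribSMul.toAddMonoidHom _ τ) m P, hτP]
  have hstab : ∀ Q ∈ Φ, τ • Q ∈ Φ := fun Q hQ ↦ by rw [hfixΦ Q hQ]; exact hQ
  -- the scalar on the quotient `E[p]/Φ`
  have hE := Rank1Residual.natCard_geomTorsion W p
  obtain ⟨d, hd⟩ := exists_smul_sub_zsmul_mem_of_stable hΦ hE hstab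
  have hdp : ¬ (p : ℤ) ∣ d := by
    rintro ⟨c, rfl⟩
    -- then `τ • Q ∈ Φ` for all `Q`, so `Φ = ⊤`: contradiction with `#Φ = p < p²`
    have hall : ∀ Q : geomTorsion W (p : ℤ), τ • Q ∈ Φ := fun Q ↦ by
      have h := hd Q
      rwa [mul_comm, mul_smul, hptor, smul_zero, sub_zero] at h
    have htop : Φ = ⊤ := by
      refine eq_top_iff.mpr fun Q _ ↦ ?_
      have := hall (τ⁻¹ • Q)
      rwa [smul_inv_smul] at this
    have := hΦ
    rw [htop, AddSubgroup.card_top, hE, pow_two] at this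
    exact absurd this (by nlinarith [hpp.one_lt])
  -- Fermat: `d^{p-1} ≡ 1 (mod p)`
  have hpi : Prime (p : ℤ) := Nat.prime_iff_prime_int.mp hpp
  have hfermat : ∀ Q : geomTorsion W (p : ℤ), (d ^ (p - 1)) • Q = Q := by
    intro Q
    have h1 : d ^ (p - 1) ≡ 1 [ZMOD p] :=
      Int.ModEq.pow_card_sub_one_eq_one hpp ((hpi.coprime_iff_not_dvd.mpr hdp).symm)
    obtain ⟨c, hc⟩ := (Int.modEq_iff_dvd.mp h1.symm)
    have h2 : d ^ (p - 1) = 1 + (p : ℤ) * c := by linarith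
    rw [h2, add_smul, one_smul, mul_comm, mul_smul, hptor, smul_zero, add_zero]
  -- `τ^{p-1}` is unipotent
  have hfix : ∀ Q ∈ Φ, (τ ^ (p - 1)) • Q = Q := fun Q hQ ↦ by
    rw [pow_smul_eq_pow_zsmul (k := 1) (fun R hR ↦ by rw [one_smul]; exact hfixΦ R hR) (p - 1) Q hQ,
      one_pow, one_smul]
  have hquot : ∀ Q : geomTorsion W (p : ℤ), (τ ^ (p - 1)) • Q - Q ∈ Φ := fun Q ↦ by
    have h := pow_smul_sub_pow_zsmul_mem hstab hd (p - 1) Q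
    rwa [hfermat Q] at h
  -- so `τ^{(p-1)p}` is trivial on `E[p]`
  have htriv : ∀ Q : geomTorsion W (p : ℤ), (τ ^ ((p - 1) * p)) • Q = Q := fun Q ↦ by
    rw [pow_mul]; exact pow_prime_smul_eq_self_of_unipotent hfix hquot Q
  have hone : galoisRepTorsion W (p : ℤ) (τ ^ ((p - 1) * p)) = 1 :=
    (galoisRepTorsion_eq_one_iff' W (p : ℤ) _).mpr htriv
  rw [map_pow] at hone
  have hdvd : p ^ 2 - 1 ∣ (p - 1) * p := hordτ ▸ orderOf_dvd_of_pow_eq_one hone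
  -- `p² - 1 ∣ p(p-1)` is absurd
  have hpos : 0 < (p - 1) * p := Nat.mul_pos (by have := hpp.two_le; omega) hpp.pos
  have hle := Nat.le_of_dvd hpos hdvd
  have h2 := hpp.two_le
  have : p ^ 2 - 1 > (p - 1) * p := by
    have : (p - 1) * p = p ^ 2 - p := by rw [pow_two, Nat.sub_mul, one_mul]
    rw [this]; omega
  omega

omit [W.IsElliptic] [W.IsGloballyMinimal] hp in
/-- The place of `ℚ` containing the prime number `p` is sent to `p` by `primesEquiv` (plumbing; contrapositive of the
tree's `Rat.natCast_not_mem_asIdeal_of_not_dvd`). [folklore] -/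
theorem primesEquiv_eq_of_natCast_mem (hpp : p.Prime) {v : HeightOneSpectrum (𝓞 ℚ)}
    (hv : ((p : ℕ) : 𝓞 ℚ) ∈ v.asIdeal) : ((primesEquiv v : Nat.Primes) : ℕ) = p := by
  have hdvd : ((primesEquiv v : Nat.Primes) : ℕ) ∣ p := by
    by_contra h
    exact Rat.natCast_not_mem_asIdeal_of_not_dvd h hv
  exact (Nat.prime_dvd_prime_iff_eq (primesEquiv v).2 hpp).mp hdvd

/-- **`E[p]^{D_v} = 0` at a good supersingular `p ≠ 2`**, for the decomposition group `D_v = GreenbergSelmer.decomp v` of the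
tree's chosen embedding `ℚ̄ → ℚ̄_v` (`v` the place of `p`): it contains the inertia group of the prime
`𝔓₀ = adicCompletionPrime ℚ v` above `v` (`decompositionSubgroup_adicCompletionPrime_eq_range`), to which
`geomTorsion_eq_zero_of_forall_inertia_smul_eq` applies. [cite: Serre1972, §1.11 Prop. 12 c)]
[cite: NeukirchANT1999, Ch. II §9 Prop. (9.6)] -/
theorem geomTorsion_eq_zero_of_forall_decomp_smul_eq (hp2 : p ≠ 2) (hss : GoodSS W p)
    {v : HeightOneSpectrum (𝓞 ℚ)} (hv : ((p : ℕ) : 𝓞 ℚ) ∈ v.asIdeal)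
    (P : geomTorsion W (p : ℤ)) (hP : ∀ σ ∈ GreenbergSelmer.decomp v, σ • P = P) : P = 0 := by
  refine geomTorsion_eq_zero_of_forall_inertia_smul_eq W p hp2 hss (primesEquiv_eq_of_natCast_mem p hp.out hv)
    (adicCompletionPrime_mem_primesAbove ℚ v) P fun σ hσ ↦ hP σ ?_
  have hσD : σ ∈ (adicCompletionPrime ℚ v).decompositionSubgroup (absoluteGaloisGroup ℚ) :=
    Ideal.inertia_le_decompositionSubgroup (absoluteGaloisGroup ℚ) _ hσ
  rw [decompositionSubgroup_adicCompletionPrime_eq_range] at hσD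
  exact hσD

/-- **`GoodSS W p`, `p ≠ 2` ⟹ `CleanAtP W p`** — «`E(ℚ_p)[p] = 0`» at a good supersingular odd prime, for EVERY elliptic
curve over `ℚ` (global minimal model): a `p`-primary torsion point killed by `p` and fixed by `D_v` is a `D_v`-fixed point of
`E[p]`, hence zero.  Discharges hypothesis (c3)-at-`p` of the per-pair Conjecture-A certificates
(`CoatesSujatha2005.conjA_of_not_dvd_card_classGroup` / `conjA_of_eigenHom_subfield`, Deo–Ray–Sujatha 2023 Thm. 3.9) on the
supersingular classes. [cite: Serre1972, §1.11 Prop. 12 c)] [cite: DeoRaySujatha2023, §3 hypothesis (c3) (arXiv:2202.09937 pp. 9–10)]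
[cite: RaySujatha2021, §2 after Def. 2.8 (arXiv:2112.13335 p. 7)] -/
theorem cleanAtP_of_goodSS (hp2 : p ≠ 2) (hss : GoodSS W p) : CleanAtP W p := by
  intro v hv x hx hfix
  have hx' : ((p : ℕ) : ℤ) • (x : geomPoints W) = 0 := by
    have h := congrArg Subtype.val hx
    rw [AddSubmonoidClass.coe_nsmul, ZeroMemClass.coe_zero, ← natCast_zsmul] at h
    exact h
  have hxmem : (x : geomPoints W) ∈ geomTorsion W (p : ℤ) := (Submodule.mem_torsionBy_iff _ _).mpr hx'
  have hP : ∀ σ ∈ GreenbergSelmer.decomp v, σ • (⟨x, hxmem⟩ : geomTorsion W (p : ℤ)) = ⟨x, hxmem⟩ := by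
    intro σ hσ
    have h := hfix σ hσ
    rw [Subtype.ext_iff, primaryComponent.coe_smul] at h
    exact Subtype.ext (by rw [AddSubgroup.torsionBy.coe_smul]; exact h)
  have h0 := geomTorsion_eq_zero_of_forall_decomp_smul_eq W p hp2 hss hv ⟨x, hxmem⟩ hP
  rw [Subtype.ext_iff] at h0
  exact Subtype.ext (by rw [ZeroMemClass.coe_zero]; exact h0)

omit W p hp in
/-- **`CleanAtPOnGoodSS` — the body of `Lines/fine_pivot.lean`'s support stub `stub_cleanAtP_goodSS`, VERBATIM, PROVED**:
`∀ W p, p ≠ 2 → GoodSS W p → CleanAtP W p`. [cite: Serre1972, §1.11 Prop. 12 c)] [cite: DeoRaySujatha2023, §3 (c3)] -/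
theorem cleanAtPOnGoodSS : ∀ (W : WeierstrassCurve ℚ) [W.IsElliptic] [W.IsGloballyMinimal] (p : ℕ) [Fact p.Prime],
    p ≠ 2 → GoodSS W p → CleanAtP W p :=
  fun W _ _ p _ hp2 hss ↦ cleanAtP_of_goodSS W p hp2 hss

/-- **On crux M's domain** (`p ≠ 2`, `ClassX7 W p` = good supersingular ∧ `N` non-square-free): `CleanAtP W p`.
[cite: Serre1972, §1.11 Prop. 12 c)] -/
theorem cleanAtP_of_classX7 (hp2 : p ≠ 2) (hX : ClassX7 W p) : CleanAtP W p :=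
  cleanAtP_of_goodSS W p hp2 hX.1

end Summit.BirchSwinnertonDyer.BirchSwinnertonDyer.Theorems.SmallImageCleanAtP

end
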